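import Literature.MathematicalPhysics.QuantumFieldTheory.Balaban1983to89.Beta.AveragingContours
import Summits.QuantumFields.BalabanUV.Beta.D1BFx.GhostLeg

/-!
# `BalabanUV.Beta.D1BFx.GhostStencil` — road «BF-x» for binder row D1, typer object T6 (scoped v1): THE COLOUR-STRIPPED GHOST STENCILS ON
# THE FINE LATTICE `ℤ⁴` — the ghost-kinetic first jet (antisymmetric lattice current on one fine bond), its same-bond second-order contact,
# and the first jet of the block averaging of `𝔤`-valued scalars with adjoint transport along the axial block contours — as `Unit`-fibred
# kernels indexed by the fine bond, with localisation sockets and translation covariance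

HONEST DEPENDENCY (page 1, mandatory): continuum YM on T⁴ ⇐ BetaPertH ∧ nine spine estimates (0/9 proved); BetaPertH ⇐ (D1) ∧ (D4) ∧
CAP+tail; G-an2-4 gates asym, D1 and NE2/3/4.  HONEST FRAMING: discharging `BetaPertH` makes Bałaban's UV stability UNCONDITIONAL — NOT
the continuum limit and NOT the Clay problem.  THIS FILE DISCHARGES NOTHING: it types OBJECTS (definitions asserting nothing) and proves
[folklore] finite bookkeeping about them (support, size, translation); 0 binders of the hR root are touched.
ABSOLUTE RULE (cell charter, verbatim): «No internally-minted statement may enter as a cited fact. Every hypothesis is either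
kernel-proved in this package or a verbatim quotation of a PUBLISHED theorem with page reference. The manuscript(s) under audit are NOT
citable for their own disputed steps — they are the thing under adjudication; programme-internal (2001/route/tribunal) claims are never
citable.»  Accordingly there is NO `def … : Prop` below and no hypothesis of any theorem is a printed statement.

WHAT IS TYPED (`HOME/b2b-balaban-beta-d1-p2/TYPER-SPEC-D1BFx.md` §1 T6, skeleton v1.4 node O2; kernels `ExpKernelCalculus.MKer 4 Unit`
indexed by the FINE bond `(κ′, u) = ⟨u, u + e_κ′⟩`, `e_κ′ = AffineAveraging.unitVec κ′ = Pi.single κ′ 1`):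
* §1 `ghCur κ′ u` — the GHOST-KINETIC FIRST JET in the `ad(t_c)`-coefficient (colour-stripped) convention of `Beta.StepJetData` §5: the
  antisymmetric lattice current `[x = u + e_κ′][z = u] − [x = u][z = u + e_κ′]`, a TRANSCRIPTION (definition, not derivation) to `ℤ⁴` of
  an3's `Beta.GhostTable.vertex₁_eq_current` (`current x e A = elemIns (x+e) x A − elemIns x (x+e) A`, `Aᵀ = −A`, rows = first argument;
  the adjoint covariant difference is `Beta.BackgroundVertices.covD`, [Balaban1985BackgroundPropagators] pp. 390–391 (3.2)–(3.3) = locator).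
* §2 `ghCnt κ′ u` — the same-bond SECOND-ORDER CONTACT `[x = z = u + e_κ′]` (`GhostTable.vertex₂_eq`, colour weight `AᵀA` EXTERNAL) and the
  bond-diagonal family `Wgh cW κ′ u λ′ u′ := [κ′ = λ′ ∧ u = u′]·cW·ghCnt κ′ u` (cross-bond second jets of `D_U*D_U` vanish, `GhostTable.cross_eq_zero`).
  SCOPE CAVEAT: the second jets of the block averaging `Q′(U)` are NOT typed in v1 (OWED).
* §3 `bondForm κ′ u` (indicator one-form of the bond); `gammaCoeff κ′ u y x := (axial (bondForm κ′ u) y x).sum` = the SIGNED MULTIPLICITY of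
  `⟨u, u+e_κ′⟩` in the axial contour `Γ_{y,x}` ([Balaban1984PropagatorsI] p. 18 (1.7), locator) AS TYPED by an1's `Beta.AveragingContours.axial`
  (`+A` forward, `−A` backward); `qJet n κ′ u y x := n⁻⁴·[x ∈ B_n(y)]·[u ∈ B_n(y)]·gammaCoeff κ′ u (n•y) x` = the colour-stripped first jet,
  in the fine component `(κ′, u)` at `U = 1`, of the block averaging of `𝔤`-valued scalars with adjoint transport along `Γ_{ny,x}` (TYPER-SPEC
  T6; [Balaban1984PropagatorsI] p. 19 (1.8)–(1.13) locate `Q′`, nothing of them asserted).  GUARD CAVEAT: the factor `[u ∈ B_n(y)]` is REDUNDANT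
  (the bonds of `Γ_{ny,x}` lie in `B_n(y)` when `x` does) but DEFINITIONAL in v1; the redundancy lemma is OWED.  `qAnti n κ′ u x z :=
  qJet(blk x, z) − qJet(blk z, x)` = the stripped jet of `Q′(U)*Q′(U)` in the `η`-weighted units of `GhostLeg.AX_pred_apply` (`Q′*Q′ ↦
  n⁻⁴·1[same n-block]`), the ROW leg carrying `ad(t_c)` (so the table is antisymmetric, like `ghCur`).
* §4 `Sgh n cK cQ κ′ u := cK·ghCur κ′ u + cQ·qAnti n κ′ u`, REAL weights; the AX-units reading `(cK, cQ) = (n², a)` holds only UP TO colour weight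
  and sign conventions — the identification is the road owner's CHECK-N0, NOTHING asserted here.
SOCKETS ([folklore]): antisymmetry; `BiLoc (ghCur κ′ u) u u e^{δ} δ`, `BiLoc (ghCnt κ′ u) u u e^{2δ} δ`, `BiLoc (Wgh …) u u′ (|cW|e^{2δ}) δ`, `|qJet| ≤ 4/n³`,
`BiLoc (qAnti n κ′ u) u u ((8/n³)e^{8δ}) (δ/n)`, `BiLoc (Sgh …) u u (…) (δ/n)`; translation covariance `… κ′ (u+v) = shiftK (−v) (…)` for `ghCur`/`ghCnt`/
`gammaCoeff` (every fine `v`) and `qJet`/`qAnti`/`Sgh` (block vectors `n•t`).  NOT HERE: colour weights, `Q′(U)` second jets, identification with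
Bałaban's normalisations, propagator bounds, anything about [Balaban1987RG1] (4.40)–(4.41).  Unit `b2b-balaban-beta-d1-formalise-typer` (planner seat;
filed by a prover-role courier).
-/


namespace Summit.QuantumFields.BalabanUV.Beta.D1BFx.GhostStencil

open Literature.MathematicalPhysics.QuantumFieldTheory.Balaban1983to89
open Literature.MathematicalPhysics.QuantumFieldTheory.Balaban1983to89.Beta
open B12Sec2to5 (l1 l1_nonneg)
open B6QGQLower276 (X side blk loc sameBlk side_facts side_mul_blk_add_loc loc_nonneg loc_lt)
open ExpKernelCalculus (Site MKer BiLoc shiftK)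
open AffineAveraging (Form1 unitVec unitVec_apply)
open AveragingContours (seg segUp segDown axialAux axial axial_add shift axial_length_le)
open GhostLeg (pred_add_one side_pred blk_translate blk_pred_apply)

noncomputable section

/-! ## §1 The ghost-kinetic first jet: the antisymmetric lattice current on one fine bond -/

/-- [our object] **THE GHOST-KINETIC FIRST-ORDER STENCIL** at the fine bond `⟨u, u + e_κ′⟩`, colour-stripped (`ad(t_c)`-coefficient
convention): `ghCur κ′ u x z = [x = u + e_κ′][z = u] − [x = u][z = u + e_κ′]` — transcription of `GhostTable.current` at `C := Unit`.
A definition; asserts nothing. -/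
def ghCur (κ' : Fin 4) (u : Site 4) : MKer 4 Unit := fun x z _ _ =>
  (if x = u + unitVec κ' ∧ z = u then (1 : ℝ) else 0) - (if x = u ∧ z = u + unitVec κ' then (1 : ℝ) else 0)

variable (κ' : Fin 4) (u : Site 4)

/-- [our object] Unfolding `ghCur`. -/
theorem ghCur_apply (x z : Site 4) (a b : Unit) : ghCur κ' u x z a b =
    (if x = u + unitVec κ' ∧ z = u then (1 : ℝ) else 0) - (if x = u ∧ z = u + unitVec κ' then (1 : ℝ) else 0) := rfl

/-- [folklore] A unit vector is not zero. -/
theorem unitVec_ne_zero : (unitVec κ' : Site 4) ≠ 0 := by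
  intro h; simpa [unitVec_apply] using congr_fun h κ'

/-- [folklore] `|e_κ′|₁ = 1`. -/
theorem l1_unitVec : l1 (unitVec κ' : Site 4) = 1 := by
  unfold l1
  rw [Finset.sum_eq_single κ' (fun μ _ hμ => by simp [unitVec_apply, hμ]) (fun h => absurd (Finset.mem_univ _) h)]
  simp [unitVec_apply]

/-- [folklore] `|0|₁ = 0`. -/
theorem l1_zero : l1 (0 : Site 4) = 0 := by
  simp [l1]

/-- [folklore] **ANTISYMMETRY** of the current under exchange of the two legs (it is the coefficient of the antisymmetric colour
insertion `ad(t_c)` in a symmetric operator). -/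
theorem ghCur_antisymm (x z : Site 4) (a b : Unit) : ghCur κ' u z x b a = -ghCur κ' u x z a b := by
  simp only [ghCur_apply]
  rw [if_congr (and_comm (a := z = u + unitVec κ') (b := x = u)) (rfl : (1 : ℝ) = 1) (rfl : (0 : ℝ) = 0),
    if_congr (and_comm (a := z = u) (b := x = u + unitVec κ')) (rfl : (1 : ℝ) = 1) (rfl : (0 : ℝ) = 0)]
  ring

/-- [folklore] **FINE-TRANSLATION COVARIANCE** (every fine vector `v`): `ghCur κ′ (u + v) = shiftK (−v) (ghCur κ′ u)` — the shape of `StepJetData.wilsonA_translate`. -/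
theorem ghCur_translate (v : Site 4) : ghCur κ' (u + v) = shiftK (-v) (ghCur κ' u) := by
  funext x z a b
  show ghCur κ' (u + v) x z a b = ghCur κ' u (x + -v) (z + -v) a b
  simp only [ghCur_apply, ← sub_eq_add_neg, sub_eq_iff_eq_add, add_right_comm u v (unitVec κ')]

/-- [folklore] **LOCALISATION SOCKET**: the current is supported on `{l1(x−u) + l1(z−u) = 1}`, so `BiLoc (ghCur κ′ u) u u e^{δ} δ` for every
real `δ` (no sign needed: the weight is `e^{δ}·e^{−δ} = 1` on the support). -/
theorem biLoc_ghCur (δ : ℝ) : BiLoc (ghCur κ' u) u u (Real.exp δ) δ := by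
  intro x z a b
  simp only [ghCur_apply]
  by_cases h1 : x = u + unitVec κ' ∧ z = u
  · obtain ⟨hx, hz⟩ := h1
    have h2 : ¬(x = u ∧ z = u + unitVec κ') := fun h =>
      unitVec_ne_zero κ' (add_left_cancel (show u + unitVec κ' = u + 0 by rw [add_zero, ← hx]; exact h.1))
    rw [if_pos ⟨hx, hz⟩, if_neg h2, sub_zero, abs_one, hx, hz, add_sub_cancel_left, sub_self, l1_unitVec, l1_zero, add_zero,
      mul_one, ← Real.exp_add, add_neg_cancel, Real.exp_zero]
  · by_cases h2 : x = u ∧ z = u + unitVec κ'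
    · obtain ⟨hx, hz⟩ := h2
      rw [if_neg h1, if_pos ⟨hx, hz⟩, zero_sub, abs_neg, abs_one, hx, hz, sub_self, add_sub_cancel_left, l1_unitVec, l1_zero,
        zero_add, mul_one, ← Real.exp_add, add_neg_cancel, Real.exp_zero]
    · rw [if_neg h1, if_neg h2, sub_zero, abs_zero]; positivity

/-! ## §2 The ghost-kinetic second jet: the same-bond contact -/

/-- [our object] **THE SAME-BOND SECOND-ORDER CONTACT** `ghCnt κ′ u x z = [x = u + e_κ′][z = u + e_κ′]` (transcription of
`GhostTable.vertex₂_eq` at the colourless instance; the colour weight `AᵀA` is external).  A definition; asserts nothing. -/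
def ghCnt (κ' : Fin 4) (u : Site 4) : MKer 4 Unit := fun x z _ _ =>
  if x = u + unitVec κ' ∧ z = u + unitVec κ' then (1 : ℝ) else 0

/-- [our object] Unfolding `ghCnt`. -/
theorem ghCnt_apply (x z : Site 4) (a b : Unit) :
    ghCnt κ' u x z a b = if x = u + unitVec κ' ∧ z = u + unitVec κ' then (1 : ℝ) else 0 := rfl

/-- [folklore] The contact is symmetric. -/
theorem ghCnt_symm (x z : Site 4) (a b : Unit) : ghCnt κ' u z x b a = ghCnt κ' u x z a b := by
  simp only [ghCnt_apply]
  rw [if_congr (and_comm (a := z = u + unitVec κ') (b := x = u + unitVec κ')) (rfl : (1 : ℝ) = 1) (rfl : (0 : ℝ) = 0)]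

/-- [folklore] Fine-translation covariance of the contact. -/
theorem ghCnt_translate (v : Site 4) : ghCnt κ' (u + v) = shiftK (-v) (ghCnt κ' u) := by
  funext x z a b
  show ghCnt κ' (u + v) x z a b = ghCnt κ' u (x + -v) (z + -v) a b
  simp only [ghCnt_apply, ← sub_eq_add_neg, sub_eq_iff_eq_add, add_right_comm u v (unitVec κ')]

/-- [folklore] LOCALISATION SOCKET of the contact: `BiLoc (ghCnt κ′ u) u u e^{2δ} δ` (every real `δ`). -/
theorem biLoc_ghCnt (δ : ℝ) : BiLoc (ghCnt κ' u) u u (Real.exp (2 * δ)) δ := by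
  intro x z a b
  simp only [ghCnt_apply]
  by_cases h1 : x = u + unitVec κ' ∧ z = u + unitVec κ'
  · obtain ⟨hx, hz⟩ := h1
    rw [if_pos ⟨hx, hz⟩, abs_one, hx, hz, add_sub_cancel_left, l1_unitVec, ← Real.exp_add]
    exact Real.one_le_exp (by linarith)
  · rw [if_neg h1, abs_zero]; positivity

/-- [our object] **THE TWO-BOND SECOND-ORDER GHOST-KINETIC FAMILY** with a real (colour) weight `cW`: diagonal in the bond,
`Wgh cW κ′ u λ′ u′ := [κ′ = λ′ ∧ u = u′]·cW·ghCnt κ′ u`.  SCOPE: the `Q′(U)` second jets are NOT included (v1).  A definition; asserts nothing. -/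
def Wgh (cW : ℝ) (κ' : Fin 4) (u : Site 4) (l' : Fin 4) (u' : Site 4) : MKer 4 Unit := fun x z a b =>
  if κ' = l' ∧ u = u' then cW * ghCnt κ' u x z a b else 0

/-- [folklore] LOCALISATION SOCKET of the two-bond family: `BiLoc (Wgh cW κ′ u λ′ u′) u u′ (|cW|·e^{2δ}) δ`. -/
theorem biLoc_Wgh (cW δ : ℝ) (l' : Fin 4) (u' : Site 4) :
    BiLoc (Wgh cW κ' u l' u') u u' (|cW| * Real.exp (2 * δ)) δ := by
  intro x z a b
  show |(if κ' = l' ∧ u = u' then cW * ghCnt κ' u x z a b else 0)| ≤ _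
  by_cases h : κ' = l' ∧ u = u'
  · rw [if_pos h, abs_mul, ← h.2, mul_assoc]
    exact mul_le_mul_of_nonneg_left (biLoc_ghCnt κ' u δ x z a b) (abs_nonneg _)
  · rw [if_neg h, abs_zero]; positivity

/-! ## §3 The first jet of the block averaging with adjoint transport along the axial contours -/

/-- [our object] The INDICATOR ONE-FORM of the fine bond `(κ′, u)`: `bondForm κ′ u κ w = [κ = κ′ ∧ w = u]`. -/
def bondForm (κ' : Fin 4) (u : Site 4) : Form1 4 ℝ := fun κ w => if κ = κ' ∧ w = u then (1 : ℝ) else 0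

/-- [our object] **THE CONTOUR COEFFICIENT** `gammaCoeff κ′ u y x` := the sum of the letters of `bondForm κ′ u` along an1's axial contour
`Γ_{y,x}` = the signed multiplicity of the bond `⟨u, u + e_κ′⟩` in `Γ_{y,x}` (`+1` per forward traversal, `−1` per backward one). -/
def gammaCoeff (κ' : Fin 4) (u y x : Site 4) : ℝ := (axial (bondForm κ' u) y x).sum

/-- [our object] **THE COLOUR-STRIPPED FIRST JET OF THE BLOCK AVERAGING OF `𝔤`-VALUED SCALARS** (coarse site `y` ← fine site `x`), in
the fine component `(κ′, u)` at `U = 1`: `qJet n κ′ u y x = n⁻⁴·[x ∈ B_n(y)]·[u ∈ B_n(y)]·gammaCoeff κ′ u (n•y) x` (membership through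
the block label `blk (n−1) · = y`, block side `n`; the `u`-guard is redundant but definitional in v1).  A definition; asserts nothing. -/
def qJet (n : ℕ) (κ' : Fin 4) (u y x : Site 4) : ℝ :=
  if blk (n - 1) x = y ∧ blk (n - 1) u = y then ((n : ℝ) ^ 4)⁻¹ * gammaCoeff κ' u ((n : ℤ) • y) x else 0

/-- [our object] **THE STRIPPED FIRST JET OF `Q′(U)*Q′(U)`** as a fine kernel, in the `η`-weighted units of `GhostLeg.AX_pred_apply`, row leg
carrying `ad(t_c)`: `qAnti n κ′ u x z = qJet n κ′ u (blk x) z − qJet n κ′ u (blk z) x`.  A definition; asserts nothing. -/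
def qAnti (n : ℕ) (κ' : Fin 4) (u : Site 4) : MKer 4 Unit := fun x z _ _ =>
  qJet n κ' u (blk (n - 1) x) z - qJet n κ' u (blk (n - 1) z) x

variable (n : ℕ)

/-- [our object] Unfolding `qAnti`. -/
theorem qAnti_apply (x z : Site 4) (a b : Unit) :
    qAnti n κ' u x z a b = qJet n κ' u (blk (n - 1) x) z - qJet n κ' u (blk (n - 1) z) x := rfl

/-- [folklore] `qAnti` is antisymmetric. -/
theorem qAnti_antisymm (x z : Site 4) (a b : Unit) : qAnti n κ' u z x b a = -qAnti n κ' u x z a b := by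
  simp only [qAnti_apply]
  ring

/-- [folklore] Off the guard the jet vanishes. -/
theorem qJet_eq_zero {y x : Site 4} (h : ¬(blk (n - 1) x = y ∧ blk (n - 1) u = y)) : qJet n κ' u y x = 0 := by
  unfold qJet; rw [if_neg h]

/-- [folklore] Every letter of a straight segment traversed forward is a value of the form. -/
theorem mem_segUp {A : Form1 4 ℝ} {z : Site 4} {κ : Fin 4} {m : ℕ} {a : ℝ} (h : a ∈ segUp A z κ m) : ∃ w, a = A κ w := by
  unfold segUp at h; obtain ⟨s, _, hs⟩ := List.mem_map.mp h; exact ⟨_, hs.symm⟩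

/-- [folklore] Every letter of a straight segment traversed backward is minus a value of the form. -/
theorem mem_segDown {A : Form1 4 ℝ} {z : Site 4} {κ : Fin 4} {m : ℕ} {a : ℝ} (h : a ∈ segDown A z κ m) : ∃ w, a = -A κ w := by
  unfold segDown at h; obtain ⟨s, _, hs⟩ := List.mem_map.mp h; exact ⟨_, hs.symm⟩

/-- [folklore] Every letter of a signed straight segment is `±` a value of the form. -/
theorem mem_seg {A : Form1 4 ℝ} {z : Site 4} {κ : Fin 4} {m : ℤ} {a : ℝ} (h : a ∈ seg A z κ m) :
    ∃ w, a = A κ w ∨ a = -A κ w := by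
  unfold seg at h; split_ifs at h
  · obtain ⟨w, hw⟩ := mem_segUp h; exact ⟨w, Or.inl hw⟩
  · obtain ⟨w, hw⟩ := mem_segDown h; exact ⟨w, Or.inr hw⟩

/-- [folklore] Every letter of the axial contour is `±A κ w` for some direction `κ` and site `w`. -/
theorem mem_axialAux {A : Form1 4 ℝ} {y x : Site 4} {a : ℝ} :
    ∀ m, a ∈ axialAux A y x m → ∃ κ w, a = A κ w ∨ a = -A κ w
  | 0, h => by simp [axialAux] at h
  | m + 1, h => by
      simp only [axialAux, List.mem_append] at h
      rcases h with h | h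
      · split_ifs at h with hm
        · obtain ⟨w, hw⟩ := mem_seg h; exact ⟨_, w, hw⟩
        · simp at h
      · exact mem_axialAux m h

/-- [folklore] The same for `axial = axialAux · · · 4`. -/
theorem mem_axial {A : Form1 4 ℝ} {y x : Site 4} {a : ℝ} (h : a ∈ axial A y x) : ∃ κ w, a = A κ w ∨ a = -A κ w :=
  mem_axialAux 4 h

/-- [folklore] The letters of the bond indicator along any contour have modulus `≤ 1`. -/
theorem abs_letter_le {y x : Site 4} {a : ℝ} (h : a ∈ axial (bondForm κ' u) y x) : |a| ≤ 1 := by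
  have hb : ∀ κ w, |bondForm κ' u κ w| ≤ 1 := fun κ w => by unfold bondForm; split_ifs <;> simp
  obtain ⟨κ, w, hw | hw⟩ := mem_axial h
  · rw [hw]; exact hb κ w
  · rw [hw, abs_neg]; exact hb κ w

/-- [folklore] A list of reals of modulus `≤ 1` has `|sum| ≤ length`. -/
theorem abs_sum_le_length : ∀ l : List ℝ, (∀ a ∈ l, |a| ≤ 1) → |l.sum| ≤ (l.length : ℝ)
  | [], _ => by simp
  | a :: l, h => by
      rw [List.sum_cons, List.length_cons, Nat.cast_succ]
      have ha : |a| ≤ 1 := h a (by simp)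
      have hl := abs_sum_le_length l fun b hb => h b (by simp [hb])
      exact (abs_add_le _ _).trans (by linarith)

/-- [folklore] Sites with block label `y` lie in the block `B_n(y) = n•y + {0,…,n−1}⁴`. -/
theorem mem_block_of_blk_eq [NeZero n] {x y : Site 4} (h : blk (n - 1) x = y) (i : Fin 4) :
    0 ≤ x i - ((n : ℤ) • y) i ∧ x i - ((n : ℤ) • y) i < (n : ℕ) := by
  subst h
  have h1 := side_mul_blk_add_loc (n - 1) x i; have h2 := loc_nonneg (n - 1) x i; have h3 := loc_lt (n - 1) x i
  rw [side_pred] at h1 h3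
  have h4 : x i - ((n : ℤ) • blk (n - 1) x) i = loc (n - 1) x i := by rw [Pi.smul_apply, smul_eq_mul]; linarith
  exact h4 ▸ ⟨h2, h3⟩

/-- [folklore] **SIZE OF THE CONTOUR COEFFICIENT** inside the block: `|gammaCoeff κ′ u (n•y) x| ≤ |Γ_{ny,x}| ≤ 4(n−1) ≤ 4n`
(`AveragingContours.axial_length_le` BY NAME). -/
theorem abs_gammaCoeff_le [NeZero n] {x y : Site 4} (h : blk (n - 1) x = y) : |gammaCoeff κ' u ((n : ℤ) • y) x| ≤ 4 * (n : ℝ) := by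
  have hlen := axial_length_le (bondForm κ' u) ((n : ℤ) • y) x n (mem_block_of_blk_eq n h)
  have h1 := abs_sum_le_length (axial (bondForm κ' u) ((n : ℤ) • y) x) (fun a ha => abs_letter_le κ' u ha)
  have h2 : (4 * (n - 1) : ℕ) ≤ 4 * n := Nat.mul_le_mul_left 4 (Nat.sub_le n 1)
  unfold gammaCoeff
  calc |(axial (bondForm κ' u) ((n : ℤ) • y) x).sum| ≤ ((axial (bondForm κ' u) ((n : ℤ) • y) x).length : ℝ) := h1
    _ ≤ ((4 * n : ℕ) : ℝ) := by exact_mod_cast hlen.trans h2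
    _ = 4 * (n : ℝ) := by push_cast; ring

/-- [folklore] **SIZE OF THE JET**: `|qJet n κ′ u y x| ≤ 4/n³` (the `n⁻⁴` weight times at most `4n` bonds). -/
theorem abs_qJet_le [NeZero n] (y x : Site 4) : |qJet n κ' u y x| ≤ 4 / (n : ℝ) ^ 3 := by
  have hn : (0 : ℝ) < n := Nat.cast_pos.mpr (Nat.pos_of_ne_zero (NeZero.ne n))
  have hn' : (n : ℝ) ≠ 0 := hn.ne'
  unfold qJet
  split_ifs with h
  · rw [abs_mul, abs_inv, abs_of_pos (pow_pos hn 4)]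
    have h1 := abs_gammaCoeff_le κ' u n h.1
    calc ((n : ℝ) ^ 4)⁻¹ * |gammaCoeff κ' u ((n : ℤ) • y) x| ≤ ((n : ℝ) ^ 4)⁻¹ * (4 * n) :=
          mul_le_mul_of_nonneg_left h1 (inv_nonneg.mpr (pow_pos hn 4).le)
      _ = 4 / (n : ℝ) ^ 3 := by field_simp
  · rw [abs_zero]; positivity

/-- [folklore] Two sites with the same block label are `ℓ¹`-close: `l1 (x − w) ≤ 4n`. -/
theorem l1_sub_le_of_blk_eq [NeZero n] {x w : Site 4} (h : blk (n - 1) x = blk (n - 1) w) : l1 (x - w) ≤ 4 * (n : ℝ) := by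
  have hμ : ∀ μ : Fin 4, |(((x - w) μ : ℤ) : ℝ)| ≤ n := by
    intro μ
    have h1 := side_mul_blk_add_loc (n - 1) x μ; have h2 := side_mul_blk_add_loc (n - 1) w μ
    have h3 := loc_nonneg (n - 1) x μ; have h4 := loc_lt (n - 1) x μ
    have h5 := loc_nonneg (n - 1) w μ; have h6 := loc_lt (n - 1) w μ
    rw [side_pred] at h1 h2 h4 h6; rw [h] at h1
    have h7 : (x - w) μ = loc (n - 1) x μ - loc (n - 1) w μ := by rw [Pi.sub_apply]; linarith
    obtain ⟨h3', h4'⟩ : (0 : ℝ) ≤ ((loc (n - 1) x μ : ℤ) : ℝ) ∧ ((loc (n - 1) x μ : ℤ) : ℝ) < n := ⟨by exact_mod_cast h3, by exact_mod_cast h4⟩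
    obtain ⟨h5', h6'⟩ : (0 : ℝ) ≤ ((loc (n - 1) w μ : ℤ) : ℝ) ∧ ((loc (n - 1) w μ : ℤ) : ℝ) < n := ⟨by exact_mod_cast h5, by exact_mod_cast h6⟩
    rw [h7, Int.cast_sub, abs_le]
    constructor <;> linarith
  unfold l1
  calc ∑ μ, |(((x - w) μ : ℤ) : ℝ)| ≤ ∑ _μ : Fin 4, (n : ℝ) := Finset.sum_le_sum fun μ _ => hμ μ
    _ = 4 * (n : ℝ) := by simp

/-- [folklore] **LOCALISATION SOCKET OF THE AVERAGING JET**: `qAnti n κ′ u` is supported on `{blk x = blk z = blk u}` (one `n`-block) and bounded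
by `8/n³`, hence `BiLoc (qAnti n κ′ u) u u ((8/n³)·e^{8δ}) (δ/n)` for every `δ ≥ 0` — the block-structured rate `δ/n` of TYPER-SPEC T4's sockets. -/
theorem biLoc_qAnti [NeZero n] {δ : ℝ} (hδ : 0 ≤ δ) : BiLoc (qAnti n κ' u) u u (8 / (n : ℝ) ^ 3 * Real.exp (8 * δ)) (δ / n) := by
  have hn : (0 : ℝ) < n := Nat.cast_pos.mpr (Nat.pos_of_ne_zero (NeZero.ne n))
  have hn' : (n : ℝ) ≠ 0 := hn.ne'
  intro x z a b
  rw [qAnti_apply]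
  by_cases h : blk (n - 1) z = blk (n - 1) x ∧ blk (n - 1) u = blk (n - 1) x
  · have hx : l1 (x - u) ≤ 4 * n := l1_sub_le_of_blk_eq n h.2.symm
    have hz : l1 (z - u) ≤ 4 * n := l1_sub_le_of_blk_eq n (h.1.trans h.2.symm)
    have h1 := abs_qJet_le κ' u n (blk (n - 1) x) z
    have h2 := abs_qJet_le κ' u n (blk (n - 1) z) x
    have h3 : δ / n * (l1 (x - u) + l1 (z - u)) ≤ δ / n * (8 * n) := mul_le_mul_of_nonneg_left (by linarith) (div_nonneg hδ hn.le)
    have h4 : δ / n * (8 * n) = 8 * δ := by field_simp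
    have hE : Real.exp (-(8 * δ)) ≤ Real.exp (-(δ / n) * (l1 (x - u) + l1 (z - u))) := Real.exp_le_exp.mpr (by linarith)
    calc |qJet n κ' u (blk (n - 1) x) z - qJet n κ' u (blk (n - 1) z) x|
          ≤ |qJet n κ' u (blk (n - 1) x) z| + |qJet n κ' u (blk (n - 1) z) x| := abs_sub _ _
      _ ≤ 4 / (n : ℝ) ^ 3 + 4 / (n : ℝ) ^ 3 := add_le_add h1 h2
      _ = 8 / (n : ℝ) ^ 3 * Real.exp (8 * δ) * Real.exp (-(8 * δ)) := by
          rw [mul_assoc, ← Real.exp_add, add_neg_cancel, Real.exp_zero, mul_one]; ring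
      _ ≤ 8 / (n : ℝ) ^ 3 * Real.exp (8 * δ) * Real.exp (-(δ / n) * (l1 (x - u) + l1 (z - u))) :=
          mul_le_mul_of_nonneg_left hE (by positivity)
  · have h' : ¬(blk (n - 1) x = blk (n - 1) z ∧ blk (n - 1) u = blk (n - 1) z) :=
      fun hh => h ⟨hh.1.symm, hh.2.trans hh.1.symm⟩
    rw [qJet_eq_zero κ' u n h, qJet_eq_zero κ' u n h', sub_zero, abs_zero]; positivity

/-- [folklore] Shifting the bond and the argument together leaves the indicator form unchanged. -/
theorem shift_bondForm (v : Site 4) : shift v (bondForm κ' (u + v)) = bondForm κ' u := by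
  funext κ w
  show bondForm κ' (u + v) κ (w + v) = bondForm κ' u κ w
  simp only [bondForm, add_left_inj]

/-- [folklore] **TRANSLATION COVARIANCE OF THE CONTOUR COEFFICIENT** (every fine `v`; `AveragingContours.axial_add` BY NAME). -/
theorem gammaCoeff_translate (v y x : Site 4) : gammaCoeff κ' (u + v) (y + v) (x + v) = gammaCoeff κ' u y x := by
  unfold gammaCoeff
  rw [axial_add, shift_bondForm]

/-- [folklore] Block labels under block-lattice translations, in road units (`GhostLeg.blk_translate` with `side (n−1) = n`). -/
theorem blk_translate' [NeZero n] (p t : Site 4) : blk (n - 1) (p + (n : ℤ) • t) = blk (n - 1) p + t := by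
  have h := blk_translate (n - 1) p t
  rwa [side_pred] at h

/-- [folklore] **BLOCK-TRANSLATION COVARIANCE OF THE JET**. -/
theorem qJet_translate [NeZero n] (t y x : Site 4) : qJet n κ' (u + (n : ℤ) • t) (y + t) (x + (n : ℤ) • t) = qJet n κ' u y x := by
  unfold qJet
  rw [blk_translate', blk_translate']
  simp only [add_left_inj, smul_add, gammaCoeff_translate]

/-- [folklore] Block-translation covariance of `qAnti`, pointwise form. -/
theorem qAnti_translate_apply [NeZero n] (t x z : Site 4) (a b : Unit) :
    qAnti n κ' (u + (n : ℤ) • t) (x + (n : ℤ) • t) (z + (n : ℤ) • t) a b = qAnti n κ' u x z a b := by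
  simp only [qAnti_apply, blk_translate', qJet_translate]

/-- [folklore] **BLOCK-TRANSLATION COVARIANCE** of `qAnti` in the `shiftK` form: `qAnti n κ′ (u + n•t) = shiftK (−n•t) (qAnti n κ′ u)`. -/
theorem qAnti_translate [NeZero n] (t : Site 4) : qAnti n κ' (u + (n : ℤ) • t) = shiftK (-((n : ℤ) • t)) (qAnti n κ' u) := by
  funext x z a b
  show qAnti n κ' (u + (n : ℤ) • t) x z a b = qAnti n κ' u (x + -((n : ℤ) • t)) (z + -((n : ℤ) • t)) a b
  simpa only [neg_add_cancel_right] using qAnti_translate_apply κ' u n t (x + -((n : ℤ) • t)) (z + -((n : ℤ) • t)) a b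

/-! ## §4 The first-order ghost stencil with real weights -/

/-- [our object] **THE FIRST-ORDER GHOST STENCIL** at the fine bond `(κ′, u)` with REAL weights: `Sgh n cK cQ κ′ u := cK·ghCur κ′ u + cQ·qAnti n κ′ u`.
The identification of `(cK, cQ)` with Bałaban's normalisation (AX-units reading: `(n², a)` up to colour weight and sign) is the owner's CHECK-N0;
nothing asserted.  A definition. -/
def Sgh (n : ℕ) (cK cQ : ℝ) (κ' : Fin 4) (u : Site 4) : MKer 4 Unit := fun x z a b =>
  cK * ghCur κ' u x z a b + cQ * qAnti n κ' u x z a b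

variable (cK cQ : ℝ)

/-- [our object] Unfolding `Sgh`. -/
theorem Sgh_apply (x z : Site 4) (a b : Unit) : Sgh n cK cQ κ' u x z a b = cK * ghCur κ' u x z a b + cQ * qAnti n κ' u x z a b := rfl

/-- [folklore] The stencil is antisymmetric. -/
theorem Sgh_antisymm (x z : Site 4) (a b : Unit) : Sgh n cK cQ κ' u z x b a = -Sgh n cK cQ κ' u x z a b := by
  rw [Sgh_apply, Sgh_apply, ghCur_antisymm, qAnti_antisymm]
  ring

/-- [folklore] **BLOCK-TRANSLATION COVARIANCE OF THE STENCIL**: `Sgh n cK cQ κ′ (u + n•t) = shiftK (−n•t) (Sgh n cK cQ κ′ u)` — the hypothesis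
shape `hS` of `OneStepKernelFamily.vertexOfK_translate`, for block vectors. -/
theorem Sgh_translate [NeZero n] (t : Site 4) : Sgh n cK cQ κ' (u + (n : ℤ) • t) = shiftK (-((n : ℤ) • t)) (Sgh n cK cQ κ' u) := by
  funext x z a b
  simp only [Sgh_apply, ghCur_translate, qAnti_translate, shiftK]

/-- [folklore] **LOCALISATION SOCKET OF THE STENCIL** at the block-structured rate `δ/n`: `BiLoc (Sgh n cK cQ κ′ u) u u (|cK|·e^{δ/n} + |cQ|·(8/n³)·e^{8δ}) (δ/n)`. -/
theorem biLoc_Sgh [NeZero n] {δ : ℝ} (hδ : 0 ≤ δ) :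
    BiLoc (Sgh n cK cQ κ' u) u u (|cK| * Real.exp (δ / n) + |cQ| * (8 / (n : ℝ) ^ 3 * Real.exp (8 * δ))) (δ / n) := by
  intro x z a b
  have hg := biLoc_ghCur κ' u (δ / n) x z a b
  have hq := biLoc_qAnti κ' u n hδ x z a b
  rw [Sgh_apply]
  calc |cK * ghCur κ' u x z a b + cQ * qAnti n κ' u x z a b|
        ≤ |cK * ghCur κ' u x z a b| + |cQ * qAnti n κ' u x z a b| := abs_add_le _ _
    _ = |cK| * |ghCur κ' u x z a b| + |cQ| * |qAnti n κ' u x z a b| := by rw [abs_mul, abs_mul]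
    _ ≤ |cK| * (Real.exp (δ / n) * Real.exp (-(δ / n) * (l1 (x - u) + l1 (z - u)))) +
        |cQ| * (8 / (n : ℝ) ^ 3 * Real.exp (8 * δ) * Real.exp (-(δ / n) * (l1 (x - u) + l1 (z - u)))) :=
          add_le_add (mul_le_mul_of_nonneg_left hg (abs_nonneg _)) (mul_le_mul_of_nonneg_left hq (abs_nonneg _))
    _ = (|cK| * Real.exp (δ / n) + |cQ| * (8 / (n : ℝ) ^ 3 * Real.exp (8 * δ))) *
        Real.exp (-(δ / n) * (l1 (x - u) + l1 (z - u))) := by ring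

end

end Summit.QuantumFields.BalabanUV.Beta.D1BFx.GhostStencil
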